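import Summits.AtomisticToContinuum.Crystallization.Theses.GrandCanonicalSelection
import Literature.MathematicalPhysics.StatisticalMechanics.LennardJonesClusters
import Literature.MathematicalPhysics.StatisticalMechanics.StablePotentialsProofs

/-!
# `GrandCanonicalSelection.KosselPointwise` (stmt-AtomisticToContinuum-13688) — proof

TWO-SIDED KOSSEL BOUNDS at a selected `N`. If `N = n + 1` is an `(ε, 1)`-local minimum of `E(·) − e·(·)`
(`E(n+1) − e (n+1) ≤ E(n) − e n + ε` and `≤ E(n+2) − e (n+2) + ε`), then in every Lennard-Jones ground state
`y` on `n + 1` particles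
* (removal) every site energy is `≤ E(n+1) − E(n) ≤ e + ε` — delete the particle, the rest is an admissible
  `n`-configuration (`groundStateEnergy_lennardJones_le`, `interactionEnergy_eq_succAbove_add_siteEnergy`, tree `lennardJones_zero`);
* (insertion) every empty point `h` binds by `Σ_i V(|h − y_i|) ≥ E(n+2) − E(n+1) ≥ e − ε` — adjoin `h`
  (`Fin.cons`), an admissible `(n+2)`-configuration.

DOOR item of route-AtomisticToContinuum-KosselSieveDial (decomp-a2c lens 5, generation 9); a prover lands it with
`--workitem stmt-AtomisticToContinuum-13688`.
-/

namespace Summit.AtomisticToContinuum.Crystallization.Theorems.GrandCanonicalSelectionKosselPointwise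

open Literature.MathematicalPhysics.StatisticalMechanics

/-- **Removal.** In a ground state on `n + 1` particles every site energy is at most the increment `E(n+1) − E(n)`. -/
theorem siteEnergy_le_increment {n : ℕ} {y : Fin (n + 1) → EuclideanSpace ℝ (Fin 3)}
    (hy : IsGroundState lennardJones y) (i : Fin (n + 1)) :
    siteEnergy lennardJones y i ≤ groundStateEnergy lennardJones 3 (n + 1) - groundStateEnergy lennardJones 3 n := by
  have hinj : Function.Injective (y ∘ i.succAbove) := hy.1.comp Fin.succAbove_right_injective
  have hle : groundStateEnergy lennardJones 3 n ≤ interactionEnergy lennardJones (y ∘ i.succAbove) :=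
    groundStateEnergy_lennardJones_le hinj
  have hsplit := interactionEnergy_eq_succAbove_add_siteEnergy lennardJones lennardJones_zero y i
  have hE : interactionEnergy lennardJones y = groundStateEnergy lennardJones 3 (n + 1) := hy.2
  linarith

/-- **Insertion.** In a ground state on `n + 1` particles every empty point `h` binds by at most the increment:
`E(n+2) − E(n+1) ≤ Σ_i V(|h − y_i|)`. -/
theorem increment_le_insertion {n : ℕ} {y : Fin (n + 1) → EuclideanSpace ℝ (Fin 3)}
    (hy : IsGroundState lennardJones y) {h : EuclideanSpace ℝ (Fin 3)} (hh : h ∉ Set.range y) :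
    groundStateEnergy lennardJones 3 (n + 2) - groundStateEnergy lennardJones 3 (n + 1)
      ≤ ∑ i : Fin (n + 1), lennardJones (dist h (y i)) := by
  set y' : Fin (n + 1 + 1) → EuclideanSpace ℝ (Fin 3) := Fin.cons h y with hy'
  have hinj : Function.Injective y' := Fin.cons_injective_iff.2 ⟨hh, hy.1⟩
  have hle : groundStateEnergy lennardJones 3 (n + 2) ≤ interactionEnergy lennardJones y' :=
    groundStateEnergy_lennardJones_le hinj
  have hsplit := interactionEnergy_eq_succAbove_add_siteEnergy lennardJones lennardJones_zero y' 0
  have hcomp : y' ∘ (0 : Fin (n + 1 + 1)).succAbove = y := by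
    funext k
    simp [y']
  have hsite : siteEnergy lennardJones y' 0 = ∑ i : Fin (n + 1), lennardJones (dist h (y i)) := by
    rw [siteEnergy_eq_sum_succAbove]
    simp [y']
  have hE : interactionEnergy lennardJones y = groundStateEnergy lennardJones 3 (n + 1) := hy.2
  rw [hcomp, hsite, hE] at hsplit
  linarith

/-- PROOF OF THE ITEM `GrandCanonicalSelection.KosselPointwise` (stmt-AtomisticToContinuum-13688, verbatim type). -/
theorem kosselPointwise :
    Summit.AtomisticToContinuum.Crystallization.Theses.GrandCanonicalSelection.KosselPointwise := by
  intro e ε n h1 h2 y hy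
  refine ⟨fun i => ?_, fun h hh => ?_⟩
  · have := siteEnergy_le_increment hy i
    linarith
  · have := increment_le_insertion hy hh
    linarith

end Summit.AtomisticToContinuum.Crystallization.Theorems.GrandCanonicalSelectionKosselPointwise
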